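import Summits.CriticalPhenomena.PercolationContinuityZ3.Theorems.PercNearOneGluingNoHeavyLowerTailSunflowerMultiPetalKempeMarkedTICells
import HarnessLib
import HarnessLib.Audit

/-!
# `NoHeavyLowerTail` (crux stmt-CriticalPhenomena-4575), marked multigraphs, THEOREM TI2: the WEIGHTED `|S| = 1` ROWS — definitions, `ℕ`-indexed
# evaluation tables, and the finite paired-row checks for the special vertex FAR from the deleted vertex (weight at `u`)

Support file (seat `prim-l12-p2` gen 52; `--supports stmt-CriticalPhenomena-4575`; continuation of `…KempeMarkedTICells` and of g49's `…KempeMarkedStepOne`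
(p607581: `rowD1`, `single_pair_nonneg`, the tables `lbN/fCN/kerN`)).  Finite checks only (`decide +kernel` through `ℕ`-indexed tables); no `sorry`; nothing is
asserted about the crux.  Memo: run/shared/lean/prim/prim-l12/prim-l12-p2/PROOF-TI2-MARKED-MULTIGRAPHS-g51.md §3 (e), `d = 1` (the enumeration `smalld_ti2v.c`).

When the deleted vertex `y ∼ u` has exactly one outer neighbour `s'` (`S = {s'}`), the weighted cell residuals are grouped into ROWS `{ρ[s' ↦ 0], ρ[s' ↦ 1], ρ[s' ↦ 2]}`
and the row of `ρ` is paired with the row of `Φ_u ρ` (g49).  With the special vertex `s ∉ {s', u, v, y}` ('far') the weight/shift is constant along a row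
(weight `1` and shift `e_c` when `ρ s = c`, weight `2` and no shift otherwise), and the partner row carries `sw02 (ρ s)`.
* `cellW`, `rowFarW` — a weighted cell / far row with law coefficients (`α` on the one-point kernel, `β` on the base term; the law
  `TI(K) ≥ (4/3)·TI(K−y) + (2/3)·TI(K'')` of the memo is `(α, β_first, β_other) = (3, −3, −1)`, the law `(1,1)` is `(1, −1, 0)`);
* `cellN`, `rowFN`, `cellW_eq_cellN`, `rowFarW_eq_rowFN` — `ℕ`-indexed evaluation;
* **`far_zero_pair_z0_B0/_Bpos`, `far_zero_pair_z1_B0/_Bpos`** — weight at `u`, special colour `0` (partner `2`) resp. `1` (partner `1`): the paired rows are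
  `≥ 0` over g49's complete abstract parameter space (`3⁹` base parameters × flags), with the law `(3,−3,−1)` when `y ≁ v` and `(1,−1,0)` when `y ∼ v`
  (the uniform law `(1,−1,0)` fails exactly in the flag class `(mul y u, mul y v, mul y s') = (1,0,1)`; verified beforehand in C, work/py/t2.c).
  The special colour `2` is the colour-`0` statement with the two rows exchanged.
-/

namespace Summit.CriticalPhenomena.PercolationContinuityZ3.Theorems.SunflowerPartition.Kempe

open Finset

/-! ## Weighted cells and rows (`Fin 3` definitions) -/

/-- A WEIGHTED CELL: weight `w`, coefficient `α` on the one-point kernel and `β` on the base term, type shift `e`, base type `t`, profile `k`. [this work] -/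
def cellW (w α β : ℤ) (e t k : CType) : ℤ := w * (α * kerTAbs (ctAdd t e) k + β * fC (ctAdd t e))

/-- A WEIGHTED `|S| = 1` ROW with constant weight/shift (special vertex far): cells `s' ↦ 0` (coefficient `βf`, containing the contraction term), `s' ↦ 1`,
`s' ↦ 2` (coefficient `βo`), at base type `t` of `K − y − s'`, profile `φ` of `s'`, flags `(A,B,C) = (mul y u, mul y v, mul y s') ∧ 2`. [this work] -/
def rowFarW (w α βf βo : ℤ) (e t φ : CType) (A B C : Fin 3) : ℤ :=
  cellW w α βf e (ctAdd t (xPart 0 φ)) (capAdd A C, B, 0) + cellW w α βo e (ctAdd t (xPart 1 φ)) (A, capAdd B C, 0)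
    + cellW w α βo e (ctAdd t (xPart 2 φ)) (A, B, C)

/-! ## `ℕ`-indexed tables -/

/-- `cellW` as an `ℕ`-indexed table. [this work] -/
def cellN (w α β : ℤ) (e0 e1 e2 t0 t1 t2 k0 k1 k2 : ℕ) : ℤ :=
  w * (α * kerN (cap2 (t0 + e0)) (cap2 (t1 + e1)) (cap2 (t2 + e2)) k0 k1 k2 + β * fCN (cap2 (t0 + e0)) (cap2 (t1 + e1)) (cap2 (t2 + e2)))

/-- `rowFarW` as an `ℕ`-indexed table. [this work] -/
def rowFN (w α βf βo : ℤ) (e0 e1 e2 t0 t1 t2 p0 p1 p2 A B C : ℕ) : ℤ :=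
  cellN w α βf e0 e1 e2 (cap2 (t0 + p0)) t1 t2 (cap2 (A + C)) B 0 + cellN w α βo e0 e1 e2 t0 (cap2 (t1 + p1)) t2 A (cap2 (B + C)) 0
    + cellN w α βo e0 e1 e2 t0 t1 (cap2 (t2 + p2)) A B C

/-- `cellW` evaluates through `cellN`. [this work] -/
theorem cellW_eq_cellN (w α β : ℤ) (e t k : CType) :
    cellW w α β e t k = cellN w α β e.1.val e.2.1.val e.2.2.val t.1.val t.2.1.val t.2.2.val k.1.val k.2.1.val k.2.2.val := by
  obtain ⟨e0, e1, e2⟩ := e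
  obtain ⟨t0, t1, t2⟩ := t
  obtain ⟨k0, k1, k2⟩ := k
  unfold cellW cellN ctAdd
  simp only
  rw [← kerN_val, ← fCN_val]
  simp only [← cap2_val]

/-- `rowFarW` evaluates through `rowFN`. [this work] -/
theorem rowFarW_eq_rowFN (w α βf βo : ℤ) (e t φ : CType) (A B C : Fin 3) :
    rowFarW w α βf βo e t φ A B C
      = rowFN w α βf βo e.1.val e.2.1.val e.2.2.val t.1.val t.2.1.val t.2.2.val φ.1.val φ.2.1.val φ.2.2.val A.val B.val C.val := by
  obtain ⟨t0, t1, t2⟩ := t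
  obtain ⟨p0, p1, p2⟩ := φ
  unfold rowFarW rowFN
  rw [xPart_zero_eq, xPart_one_eq, xPart_two_eq, cellW_eq_cellN, cellW_eq_cellN, cellW_eq_cellN]
  unfold ctAdd
  simp only [MGraph.capAdd_zero_right, ← cap2_val, Fin.val_zero]

/-! ## The finite paired-row checks, weight at `u`, special vertex far -/

/-- Special colour `0` (row weight `1`, shift `e₀`; partner colour `2`: weight `2`, no shift), `y ≁ v`, law `(3,−3,−1)`. (finite check, kernel) [this work] -/
theorem far_zero_pair_z0_B0N : ∀ A : Fin 3, A ≠ 0 → ∀ C : Fin 3, C ≠ 0 → ∀ Ia Ic P P' B₁ N Ta Tb Tc : Fin 3,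
    0 ≤ rowFN 1 3 (-3) (-1) 1 0 0 (cap2 (Ia.val + P.val)) B₁.val Ic.val (cap2 (N.val + Ta.val)) Tb.val Tc.val A.val 0 C.val
      + rowFN 2 3 (-3) (-1) 0 0 0 (cap2 (Ic.val + P'.val)) B₁.val Ia.val (cap2 (N.val + Tc.val)) Tb.val Ta.val A.val 0 C.val := by
  decide +kernel

/-- Special colour `0`, `y ∼ v` (`B ≠ 0`), law `(1,−1,0)`. (finite check, kernel) [this work] -/
theorem far_zero_pair_z0_BposN : ∀ A : Fin 3, A ≠ 0 → ∀ C : Fin 3, C ≠ 0 → ∀ B : Fin 3, B ≠ 0 → ∀ Ia Ic P P' B₁ N Ta Tb Tc : Fin 3,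
    0 ≤ rowFN 1 1 (-1) 0 1 0 0 (cap2 (Ia.val + P.val)) B₁.val Ic.val (cap2 (N.val + Ta.val)) Tb.val Tc.val A.val B.val C.val
      + rowFN 2 1 (-1) 0 0 0 0 (cap2 (Ic.val + P'.val)) B₁.val Ia.val (cap2 (N.val + Tc.val)) Tb.val Ta.val A.val B.val C.val := by
  decide +kernel

/-- Special colour `1` (both rows weight `2`, no shift), `y ≁ v`, law `(3,−3,−1)`. (finite check, kernel) [this work] -/
theorem far_zero_pair_z1_B0N : ∀ A : Fin 3, A ≠ 0 → ∀ C : Fin 3, C ≠ 0 → ∀ Ia Ic P P' B₁ N Ta Tb Tc : Fin 3,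
    0 ≤ rowFN 2 3 (-3) (-1) 0 0 0 (cap2 (Ia.val + P.val)) B₁.val Ic.val (cap2 (N.val + Ta.val)) Tb.val Tc.val A.val 0 C.val
      + rowFN 2 3 (-3) (-1) 0 0 0 (cap2 (Ic.val + P'.val)) B₁.val Ia.val (cap2 (N.val + Tc.val)) Tb.val Ta.val A.val 0 C.val := by
  decide +kernel

/-- Special colour `1`, `y ∼ v` (`B ≠ 0`), law `(1,−1,0)`. (finite check, kernel) [this work] -/
theorem far_zero_pair_z1_BposN : ∀ A : Fin 3, A ≠ 0 → ∀ C : Fin 3, C ≠ 0 → ∀ B : Fin 3, B ≠ 0 → ∀ Ia Ic P P' B₁ N Ta Tb Tc : Fin 3,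
    0 ≤ rowFN 2 1 (-1) 0 0 0 0 (cap2 (Ia.val + P.val)) B₁.val Ic.val (cap2 (N.val + Ta.val)) Tb.val Tc.val A.val B.val C.val
      + rowFN 2 1 (-1) 0 0 0 0 (cap2 (Ic.val + P'.val)) B₁.val Ia.val (cap2 (N.val + Tc.val)) Tb.val Ta.val A.val B.val C.val := by
  decide +kernel

/-! ## The same checks on `Fin 3` -/

/-- **Far, weight at `u`, special colour `0` vs `2`, `y ≁ v`**: paired weighted rows `≥ 0` with the law `(3,−3,−1)`. [this work] -/
theorem far_zero_pair_z0_B0 (A C : Fin 3) (hA : A ≠ 0) (hC : C ≠ 0) (Ia Ic P P' B₁ N Ta Tb Tc : Fin 3) :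
    0 ≤ rowFarW 1 3 (-3) (-1) (1, 0, 0) (capAdd Ia P, B₁, Ic) (capAdd N Ta, Tb, Tc) A 0 C
      + rowFarW 2 3 (-3) (-1) (0, 0, 0) (capAdd Ic P', B₁, Ia) (capAdd N Tc, Tb, Ta) A 0 C := by
  rw [rowFarW_eq_rowFN, rowFarW_eq_rowFN]
  simp only [← cap2_val]
  exact far_zero_pair_z0_B0N A hA C hC Ia Ic P P' B₁ N Ta Tb Tc

/-- **Far, weight at `u`, special colour `0` vs `2`, `y ∼ v`**: paired weighted rows `≥ 0` with the law `(1,−1,0)`. [this work] -/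
theorem far_zero_pair_z0_Bpos (A B C : Fin 3) (hA : A ≠ 0) (hC : C ≠ 0) (hB : B ≠ 0) (Ia Ic P P' B₁ N Ta Tb Tc : Fin 3) :
    0 ≤ rowFarW 1 1 (-1) 0 (1, 0, 0) (capAdd Ia P, B₁, Ic) (capAdd N Ta, Tb, Tc) A B C
      + rowFarW 2 1 (-1) 0 (0, 0, 0) (capAdd Ic P', B₁, Ia) (capAdd N Tc, Tb, Ta) A B C := by
  rw [rowFarW_eq_rowFN, rowFarW_eq_rowFN]
  simp only [← cap2_val]
  exact far_zero_pair_z0_BposN A hA C hC B hB Ia Ic P P' B₁ N Ta Tb Tc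

/-- **Far, weight at `u`, special colour `1`, `y ≁ v`**: law `(3,−3,−1)`. [this work] -/
theorem far_zero_pair_z1_B0 (A C : Fin 3) (hA : A ≠ 0) (hC : C ≠ 0) (Ia Ic P P' B₁ N Ta Tb Tc : Fin 3) :
    0 ≤ rowFarW 2 3 (-3) (-1) (0, 0, 0) (capAdd Ia P, B₁, Ic) (capAdd N Ta, Tb, Tc) A 0 C
      + rowFarW 2 3 (-3) (-1) (0, 0, 0) (capAdd Ic P', B₁, Ia) (capAdd N Tc, Tb, Ta) A 0 C := by
  rw [rowFarW_eq_rowFN, rowFarW_eq_rowFN]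
  simp only [← cap2_val]
  exact far_zero_pair_z1_B0N A hA C hC Ia Ic P P' B₁ N Ta Tb Tc

/-- **Far, weight at `u`, special colour `1`, `y ∼ v`**: law `(1,−1,0)`. [this work] -/
theorem far_zero_pair_z1_Bpos (A B C : Fin 3) (hA : A ≠ 0) (hC : C ≠ 0) (hB : B ≠ 0) (Ia Ic P P' B₁ N Ta Tb Tc : Fin 3) :
    0 ≤ rowFarW 2 1 (-1) 0 (0, 0, 0) (capAdd Ia P, B₁, Ic) (capAdd N Ta, Tb, Tc) A B C
      + rowFarW 2 1 (-1) 0 (0, 0, 0) (capAdd Ic P', B₁, Ia) (capAdd N Tc, Tb, Ta) A B C := by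
  rw [rowFarW_eq_rowFN, rowFarW_eq_rowFN]
  simp only [← cap2_val]
  exact far_zero_pair_z1_BposN A hA C hC B hB Ia Ic P P' B₁ N Ta Tb Tc

end Summit.CriticalPhenomena.PercolationContinuityZ3.Theorems.SunflowerPartition.Kempe
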